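import Summits.BirchSwinnertonDyer.BirchSwinnertonDyer.Theorems.EisensteinPrimesKatzLineLambdaRigidity
import Summits.BirchSwinnertonDyer.BirchSwinnertonDyer.Theorems.UniversalToricDescentBDPFlatMuTransfer
import Summits.BirchSwinnertonDyer.BirchSwinnertonDyer.Theorems.EisensteinPrimesTwoVariableKatzBranchReflectRigidity
import Summits.BirchSwinnertonDyer.Rank1Residual.X1.UnrSeriesFirstUnitCoeff
import Summits.BirchSwinnertonDyer.Rank1Residual.X11b.FramePrincipalUnitPowers
import Literature.NumberTheory.EllipticCurves.CastellaGrossiLeeSkinner2022.KatzPAdicLFunctionFrame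
import Literature.NumberTheory.EllipticCurves.KellerYin2024.AnomalousLambdaInvariants
import HarnessLib

/-!
# AN-F₂, route (RIG): `μ = 0` AND the first-unit index `λ` pass from ONE `𝓞_{ℂ_p}`-valued CGLS-type
# frame of `θ_K` to EVERY `R₀`-valued CGLS frame `IsKatzLFunction … θ_K … L` — ANY periods
# (helper file for crux `GoodLatticeBDPValue`, stmt-BirchSwinnertonDyer-19032, line `halves`, stub 3
# `stub_anDS`, piece AN-F₂ `KatzLineDescentAt` of `Cruxes/GoodLatticeBDPValue/Lines/halves_anDS_split_idea11g4`)

Seat `bsd-line-x1-p1-w4` (D-0154 width seat, crux 2 of route `EisensteinPrimes`, line `halves` v17). THEOREMS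
ONLY (no definition, no named fact, no `sorry`; no `Theses` import). `--supports stmt-BirchSwinnertonDyer-19032`.

WHAT. The ideator's AN-F₂ asks: if SOME `𝓞_{ℂ_p}`-valued CGLS-type frame `(Ω_K', Ω_p', Q)` of `θ_K`
(the `∀ (φ, n, hL, r)`-body of `IsKatzLFunction` read in `IntSeries.HasValueAt`, as produced by w2's
`KatzLineFrame.exists_katzLineIntFrame`, AN-F₁) has its first unit coefficient at `m`, then SOME
`R₀`-frame has `FirstUnitCoeffAt · m`. This file proves the TRANSFER: EVERY `R₀`-frame
`IsKatzLFunction ι v v̄ Cbar κ γ θ_K Ω_K'' Ω_p'' L` (any non-zero periods) then has `FirstUnitCoeffAt L m`,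
so AN-F₂ follows from the mere EXISTENCE of an `R₀`-frame (CGLS Thm. 2.1.2,
`thm212_exists_isKatzLFunction`, whose binders for the residual pair are w2's plumbing). Hypotheses:
`K` imaginary quadratic, `p` odd, `κ` anticyclotomic with topological generator `γ`, `θ_K` finite order.

HOW (cell bsd-cn100's power-map device, as in `UniversalToricDescentBDPFlatMuTransfer` for BDP frames).
§1 at a CGLS datum of type `(n, −n)` the second frame's value is the first's times `c^n`,
`c = ι⁻¹((Ω_K/Ω_K')²)·(Ω_p'/Ω_p)²`. §2 the Katz supply `φ_k = φ₁^{(p−1)p^k}` (`φ₁` the unitary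
interpolation character, `IwasawaTwoVariable.exists_unitary_interpolationCharacter`): `p − 1 ∣ n_k`,
`n_{k+1} = p·n_k`, points `x₀^{p^k} − 1 → 0`, non-zero, stable under `Φ`, `L(θ_Kφ_k, s)` entire (Tate).
§3 hence `L♭(Φ)·Q^p = L♭^p·Q(Φ)` (`…FlatMuTransfer.flat_powerMap_identity_of_values`) and the frames vanish
together. §4 `μ`: `…FlatMuTransfer.exists_coeff_norm_eq_one_of_flat_powerMap_identity`; `λ`:
`KatzLineRigidity.firstUnitCoeffAt_eq_of_powMap_identity`. Hida's `μ = 0` is NOT used.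

References: [CastellaGrossiLeeSkinner2022] Thm. 2.1.2; [Castella2018] Thm. 3.1; [Washington1997] §7.1–7.2.
-/

set_option linter.dupNamespace false
set_option autoImplicit false

noncomputable section

open scoped Classical Topology

open Filter PowerSeries NumberField IsDedekindDomain Field Literature.NumberTheory.EllipticCurves
  Literature.NumberTheory.EllipticCurves.CastellaGrossiLeeSkinner2022
  Literature.NumberTheory.EllipticCurves.KellerYin2024
  Literature.NumberTheory.GaloisRepresentations Literature.NumberTheory.GaloisRepresentations.HeckeCharacter
  Summit.BirchSwinnertonDyer.Rank1Residual Summit.BirchSwinnertonDyer.Rank1Residual.X11b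
  Summit.BirchSwinnertonDyer.Rank1Residual.X11b.LambdaSupply
  Summit.BirchSwinnertonDyer.Rank1Residual.X11b.Three.LambdaSupply
  Summit.BirchSwinnertonDyer.BirchSwinnertonDyer.Theorems.IwasawaTwoVariable
  Summit.BirchSwinnertonDyer.BirchSwinnertonDyer.Theorems.UniversalToricDescentFlatMuTransfer

namespace Summit.BirchSwinnertonDyer.BirchSwinnertonDyer.Theorems.KatzLineRigidity

variable {p : ℕ} [hp : Fact p.Prime] {K : Type} [Field K] [NumberField K]

/-! ### §1 Period rescaling of the CGLS interpolation value -/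

omit hp in
/-- The CGLS interpolation value is `(…)/Ω_K^{2n}`: changing `Ω_K` to `Ω_K'` multiplies it by
`((Ω_K/Ω_K')²)^n`. [cite: CastellaGrossiLeeSkinner2022, Thm. 2.1.2 (arXiv:2008.02571v2 TeX L1015–1041)] -/
theorem katzInterpolationValue_rescale (θK : HeckeCharacter K) (v vbar : HeightOneSpectrum (𝓞 K))
    (Cbar : Finset (HeightOneSpectrum (𝓞 K))) (φ : HeckeCharacter K) (n : ℕ) {ΩK ΩK' : ℂ}
    (hΩK : ΩK ≠ 0) (Lval : ℂ) :
    katzInterpolationValue p θK v vbar Cbar φ n ΩK' Lval =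
      katzInterpolationValue p θK v vbar Cbar φ n ΩK Lval * ((ΩK / ΩK') ^ 2) ^ n := by
  unfold katzInterpolationValue
  have h1 : ΩK ^ (2 * n) ≠ 0 := pow_ne_zero _ hΩK
  have key : (ΩK' ^ (2 * n))⁻¹ = (ΩK ^ (2 * n))⁻¹ * ((ΩK / ΩK') ^ 2) ^ n := by
    rw [← pow_mul, div_pow, mul_div_assoc', inv_mul_cancel₀ h1, one_div]
  rw [div_eq_mul_inv, div_eq_mul_inv, key]
  ring

/-- **The value prescribed by a frame with periods `(Ω_K', Ω_p')` is `c^n` times the value prescribed with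
periods `(Ω_K, Ω_p)`**, `c = ι⁻¹((Ω_K/Ω_K')²)·(Ω_p'/Ω_p)²`. [cite: CastellaGrossiLeeSkinner2022, Thm. 2.1.2] -/
theorem katzFrameValue_rescale (ι : PadicAlgCl p ≃+* ℂ) (θK : HeckeCharacter K)
    (v vbar : HeightOneSpectrum (𝓞 K)) (Cbar : Finset (HeightOneSpectrum (𝓞 K))) (φ : HeckeCharacter K)
    (n : ℕ) {ΩK ΩK' : ℂ} (hΩK : ΩK ≠ 0) {Ωp : ℂ_[p]} (Ωp' : ℂ_[p]) (hΩp : Ωp ≠ 0)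
    (Lval : ℂ) :
    ((ι.symm (katzInterpolationValue p θK v vbar Cbar φ n ΩK' Lval) : PadicAlgCl p) : ℂ_[p]) *
        Ωp' ^ (2 * n) =
      ((ι.symm (katzInterpolationValue p θK v vbar Cbar φ n ΩK Lval) : PadicAlgCl p) : ℂ_[p]) *
        Ωp ^ (2 * n) * (((ι.symm ((ΩK / ΩK') ^ 2) : PadicAlgCl p) : ℂ_[p]) * (Ωp' / Ωp) ^ 2) ^ n := by
  rw [katzInterpolationValue_rescale θK v vbar Cbar φ n hΩK Lval (ΩK' := ΩK')]
  have h3 : Ωp ^ (2 * n) ≠ 0 := pow_ne_zero _ hΩp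
  simp only [PadicComplex.coe_eq]
  rw [map_mul, map_mul]
  have hQ : (algebraMap (PadicAlgCl p) ℂ_[p]) (ι.symm (((ΩK / ΩK') ^ 2) ^ n)) =
      (algebraMap (PadicAlgCl p) ℂ_[p]) (ι.symm ((ΩK / ΩK') ^ 2)) ^ n := by
    rw [← map_pow, ← map_pow]
  rw [hQ]
  generalize (algebraMap (PadicAlgCl p) ℂ_[p]) (ι.symm ((ΩK / ΩK') ^ 2)) = B
  rw [mul_pow, ← pow_mul, div_pow]
  field_simp

/-! ### §2 The Katz character supply -/

/-- **A supply of CGLS data on the anticyclotomic line** (`K` imaginary quadratic, `p` odd, `κ`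
anticyclotomic with topological generator `γ`, `θ_K` of finite order): characters `φ_k = φ₁^{(p−1)p^k}`
(`φ₁` the unitary interpolation character) — unramified, of type `(n_k, −n_k)`, `0 < n_k`, `p − 1 ∣ n_k`,
`n_{k+1} = p·n_k` — with avatars `r_k` through `κ`, `r_k(γ) = x₀^{p^k} → 1`, `x₀^{p^k} ≠ 1` (`x₀ = u^{p−1}`;
a principal unit that is a `(p−1)`-st root of unity is `1`, `R1.norm_pow_sub_one_of_coprime`), and ENTIRE
`L(θ_Kφ_k, s)` (Tate: unitary, type `≠ (t, t)`, not a norm twist). [cite: Castella2018, Thm. 3.1]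
[cite: TateThesis1967, Thm. 4.4.1] [cite: Washington1997, §7.2] -/
theorem exists_katzSupply (hp2 : p ≠ 2) (ι : PadicAlgCl p ≃+* ℂ) (hK : IsImaginaryQuadratic K)
    {κ : ZpExtension K p} (hκ : κ.IsAnticyclotomic) {γ : absoluteGaloisGroup K}
    (hγ : κ.IsTopGenerator γ) {θK : HeckeCharacter K} (hfin : θK.IsFiniteOrder) :
    ∃ (n : ℕ → ℕ) (x₀ : ℂ_[p]) (φ : ℕ → HeckeCharacter K) (r : ℕ → FramedGaloisRep K (PadicAlgCl p) 1),
      (∀ k, 0 < n k) ∧ (∀ k, (p - 1) ∣ n k) ∧ (∀ k, n (k + 1) = p * n k) ∧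
      (∀ k, x₀ ^ p ^ k ≠ 1) ∧ Tendsto (fun k ↦ x₀ ^ p ^ k) atTop (𝓝 1) ∧
      (∀ k (w : HeightOneSpectrum (𝓞 K)), (φ k).IsUnramifiedAt w) ∧
      (∀ k, (φ k).HasInfinityType (fun _ ↦ ((n k : ℕ) : ℤ)) (fun _ ↦ -((n k : ℕ) : ℤ))) ∧
      (∀ k, IsPAdicAvatarOf ι (φ k) (r k)) ∧ (∀ k, FactorsThroughZp κ (r k)) ∧
      (∀ k, avatarValueAt (r k) γ = x₀ ^ p ^ k) ∧
      (∀ k, LFunction.HasEntireContinuation (heckeLFunction (θK * φ k))) := by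
  have hprime : p.Prime := hp.out
  haveI : IsTotallyComplex K := hK.2
  obtain ⟨φ₁, m₁, ψ, hm₁, hunit, hunr, hinf, hav, hfac, hx1, hne⟩ :=
    exists_unitary_interpolationCharacter hp2 ι κ hK hκ γ hγ
  set e := (FramedRep.unitsContinuousMulEquivOfUnique (Fin 1) (PadicAlgCl p) :
    (PadicAlgCl p)ˣ →ₜ* GL (Fin 1) (PadicAlgCl p)) with he
  set u : ℂ_[p] := avatarValueAt (e.comp ψ) γ with hu
  have hunr' : ∀ w : HeightOneSpectrum (𝓞 K), ((p : ℕ) : 𝓞 K) ∉ w.asIdeal → φ₁.IsUnramifiedAt w :=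
    fun w _ ↦ hunr w
  -- the exponents `N k = (p-1) p^k`
  set N : ℕ → ℕ := fun k ↦ (p - 1) * p ^ k with hN
  have hpow_inf : ∀ j : ℕ, (φ₁ ^ j).HasInfinityType (fun _ ↦ ((m₁ * j : ℕ) : ℤ))
      (fun _ ↦ -((m₁ * j : ℕ) : ℤ)) := fun j ↦ by
    have h := LambdaSupply.HasInfinityType.pow_nat hinf j
    convert h using 2 <;> push_cast <;> ring_nf
  refine ⟨fun k ↦ m₁ * N k, u ^ (p - 1), fun k ↦ φ₁ ^ N k, fun k ↦ e.comp (ψ ^ N k),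
    fun k ↦ Nat.mul_pos hm₁ (Nat.mul_pos (Nat.sub_pos_of_lt hprime.one_lt) (pow_pos hprime.pos k)),
    fun k ↦ ⟨m₁ * p ^ k, by simp only [hN]; ring⟩, fun k ↦ by simp only [hN, pow_succ]; ring,
    fun k hk ↦ ?_, ?_, fun k w ↦ isUnramifiedAt_pow' (hunr w) _, fun k ↦ hpow_inf (N k),
    fun k ↦ isPAdicAvatarOf_pow ι hav hunr' (N k),
    fun k ↦ factorsThroughZp_unitsChar_pow κ hfac (N k), fun k ↦ ?_, fun k ↦ ?_⟩
  · -- `x₀^{p^k} = u^{(p-1)p^k} ≠ 1`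
    have hw : ‖u ^ p ^ k - 1‖ < 1 := lt_of_le_of_lt (R1.norm_pow_sub_one_le hx1 _) hx1
    have hcop : p.Coprime (p - 1) := (Nat.coprime_self_sub_right hprime.one_le).mpr p.coprime_one_right
    have h1 : ‖(u ^ p ^ k) ^ (p - 1) - 1‖ = ‖u ^ p ^ k - 1‖ := R1.norm_pow_sub_one_of_coprime hw hcop
    rw [← pow_mul, mul_comm, pow_mul, hk, sub_self, norm_zero] at h1
    exact hne k (sub_eq_zero.mp (norm_eq_zero.mp h1.symm))
  · -- `x₀^{p^k} → 1`
    have hx0 : ‖u ^ (p - 1) - 1‖ < 1 := lt_of_le_of_lt (R1.norm_pow_sub_one_le hx1 _) hx1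
    exact tendsto_pow_prime_pow_padicComplex hx0
  · rw [avatarValueAt_unitsChar_pow, ← pow_mul, ← hu]
  · -- Tate's entire continuation: `θ_K φ_k` unitary, of type `(n_k, −n_k)`, not a norm twist
    have hu1 : (θK * φ₁ ^ N k).IsUnitary :=
      hfin.isUnitary.mul (CongruentShaFreeCutLambdaSupplyAnyPrime.isUnitary_pow hunit _)
    have hinf1 : (θK * φ₁ ^ N k).HasInfinityType (fun _ ↦ ((m₁ * N k : ℕ) : ℤ))
        (fun _ ↦ -((m₁ * N k : ℕ) : ℤ)) := by
      have h := (Three.LambdaSupply.hasInfinityType_zero_of_isFiniteOrder hfin).mul' (hpow_inf (N k))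
      convert h using 2 <;> simp
    have hn0 : ((m₁ * N k : ℕ) : ℤ) ≠ 0 := by
      have : 0 < m₁ * N k :=
        Nat.mul_pos hm₁ (Nat.mul_pos (Nat.sub_pos_of_lt hprime.one_lt) (pow_pos hprime.pos k))
      exact_mod_cast this.ne'
    exact heckeLFunction_hasEntireContinuation_of_not_isNormTwist_holds _ hu1
      (not_isNormTwist_of_hasInfinityType hn0 hinf1)

/-! ### §3 The power-map functional equation of two CGLS-type frames; frames vanish together -/

section Frames

variable {ι : PadicAlgCl p ≃+* ℂ} {v vbar : HeightOneSpectrum (𝓞 K)} {Cbar : Finset (HeightOneSpectrum (𝓞 K))}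
  {κ : ZpExtension K p} {γ : absoluteGaloisGroup K} {θK : HeckeCharacter K}
  {ΩK ΩK' : ℂ} {Ωp Ωp' : ℂ_[p]} {Q Q' : PowerSeries 𝓞_ℂ_[p]}

/-- **Two `𝓞_{ℂ_p}`-valued CGLS-type frames of one `θ_K` satisfy `Q'(Φ)·Q^p = Q'^p·Q(Φ)`**
(`Φ = (1+T)^p − 1`; `K` imaginary quadratic, `p` odd, `κ` anticyclotomic with topological generator
`γ`, `θ_K` of finite order, `Ω_K, Ω_p ≠ 0`): along the Katz supply (§2) the second frame's values
are `c^{n_k}` times the first's (§1), and `UniversalToricDescentFlatMuTransfer.flat_powerMap_identity_of_values`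
applies. [cite: CastellaGrossiLeeSkinner2022, Thm. 2.1.2] [cite: Washington1997, §7.2 (the p-power map)] -/
theorem katzFlat_powerMap_identity (hp2 : p ≠ 2) (hK : IsImaginaryQuadratic K) (hκ : κ.IsAnticyclotomic)
    (hγ : κ.IsTopGenerator γ) (hfin : θK.IsFiniteOrder) (hΩK : ΩK ≠ 0) (hΩp : Ωp ≠ 0)
    (hQ : ∀ (φ : HeckeCharacter K) (n : ℕ), 0 < n → (p - 1) ∣ n →
        (∀ w : HeightOneSpectrum (𝓞 K), φ.IsUnramifiedAt w) →
        φ.HasInfinityType (fun _ ↦ (n : ℤ)) (fun _ ↦ -(n : ℤ)) →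
        ∀ (hL : LFunction.HasEntireContinuation (heckeLFunction (θK * φ))),
        ∀ r : FramedGaloisRep K (PadicAlgCl p) 1, IsPAdicAvatarOf ι φ r → FactorsThroughZp κ r →
          IntSeries.HasValueAt Q (avatarValueAt r γ - 1)
            (((ι.symm (katzInterpolationValue p θK v vbar Cbar φ n ΩK (hL.continuation 1)) :
                PadicAlgCl p) : ℂ_[p]) * Ωp ^ (2 * n)))
    (hQ' : ∀ (φ : HeckeCharacter K) (n : ℕ), 0 < n → (p - 1) ∣ n →
        (∀ w : HeightOneSpectrum (𝓞 K), φ.IsUnramifiedAt w) →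
        φ.HasInfinityType (fun _ ↦ (n : ℤ)) (fun _ ↦ -(n : ℤ)) →
        ∀ (hL : LFunction.HasEntireContinuation (heckeLFunction (θK * φ))),
        ∀ r : FramedGaloisRep K (PadicAlgCl p) 1, IsPAdicAvatarOf ι φ r → FactorsThroughZp κ r →
          IntSeries.HasValueAt Q' (avatarValueAt r γ - 1)
            (((ι.symm (katzInterpolationValue p θK v vbar Cbar φ n ΩK' (hL.continuation 1)) :
                PadicAlgCl p) : ℂ_[p]) * Ωp' ^ (2 * n))) :
    Q'.subst (((1 + X : PowerSeries 𝓞_ℂ_[p]) ^ p) - 1) * Q ^ p =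
      Q' ^ p * Q.subst (((1 + X : PowerSeries 𝓞_ℂ_[p]) ^ p) - 1) := by
  obtain ⟨n, x₀, φ, r, hnpos, hndvd, hnstep, hx1, hx, hunr, hinf, hr, hrκ, hval, hL⟩ :=
    exists_katzSupply hp2 ι hK hκ hγ hfin
  have hT0 : Tendsto (fun k ↦ x₀ ^ p ^ k - 1) atTop (𝓝 0) := by
    have := hx.sub_const 1
    simpa using this
  obtain ⟨K₀, hK₀⟩ : ∃ K₀, ∀ k ≥ K₀, ‖x₀ ^ p ^ k - 1‖ < 1 := by
    have hev : ∀ᶠ k in atTop, ‖x₀ ^ p ^ k - 1‖ < 1 := by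
      have h := hT0.norm
      rw [norm_zero] at h
      exact h.eventually (gt_mem_nhds zero_lt_one)
    exact eventually_atTop.mp hev
  refine flat_powerMap_identity_of_values (x := fun k ↦ x₀ ^ p ^ (k + K₀) - 1)
    (V := fun k ↦ ((ι.symm (katzInterpolationValue p θK v vbar Cbar (φ (k + K₀)) (n (k + K₀)) ΩK
      ((hL (k + K₀)).continuation 1)) : PadicAlgCl p) : ℂ_[p]) * Ωp ^ (2 * n (k + K₀)))
    (n := fun k ↦ n (k + K₀))
    (c := ((ι.symm ((ΩK / ΩK') ^ 2) : PadicAlgCl p) : ℂ_[p]) * (Ωp' / Ωp) ^ 2)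
    (fun k ↦ hK₀ _ (Nat.le_add_left K₀ k)) (fun k ↦ sub_ne_zero.mpr (hx1 _))
    (hT0.comp (tendsto_add_atTop_nat K₀)) (fun k ↦ ?_) (fun k ↦ ?_) (fun k ↦ ?_) (fun k ↦ ?_)
  · show x₀ ^ p ^ (k + 1 + K₀) - 1 = (1 + (x₀ ^ p ^ (k + K₀) - 1)) ^ p - 1
    have e1 : k + 1 + K₀ = k + K₀ + 1 := by omega
    rw [e1, add_sub_cancel, ← pow_mul, ← pow_succ]
  · show n (k + 1 + K₀) = p * n (k + K₀)
    have e1 : k + 1 + K₀ = k + K₀ + 1 := by omega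
    rw [e1, hnstep]
  · have h := hQ (φ (k + K₀)) _ (hnpos _) (hndvd _) (hunr _) (hinf _) (hL _) (r (k + K₀)) (hr _) (hrκ _)
    rw [hval] at h
    exact h
  · have h := hQ' (φ (k + K₀)) _ (hnpos _) (hndvd _) (hunr _) (hinf _) (hL _) (r (k + K₀)) (hr _)
      (hrκ _)
    rw [hval, katzFrameValue_rescale ι θK v vbar Cbar (φ (k + K₀)) (n (k + K₀)) hΩK Ωp' hΩp] at h
    exact h

/-- **Two CGLS-type frames vanish together** (the second's values are `c^n` times `0` along the
supply; identity principle). [cite: CastellaGrossiLeeSkinner2022, Thm. 2.1.2] [cite: Cassels1986, Ch. 4 Thm. 4.1] -/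
theorem katzFlat_eq_zero_of_eq_zero (hp2 : p ≠ 2) (hK : IsImaginaryQuadratic K)
    (hκ : κ.IsAnticyclotomic) (hγ : κ.IsTopGenerator γ) (hfin : θK.IsFiniteOrder) (hΩK : ΩK ≠ 0)
    (hΩp : Ωp ≠ 0)
    (hQ : ∀ (φ : HeckeCharacter K) (n : ℕ), 0 < n → (p - 1) ∣ n →
        (∀ w : HeightOneSpectrum (𝓞 K), φ.IsUnramifiedAt w) →
        φ.HasInfinityType (fun _ ↦ (n : ℤ)) (fun _ ↦ -(n : ℤ)) →
        ∀ (hL : LFunction.HasEntireContinuation (heckeLFunction (θK * φ))),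
        ∀ r : FramedGaloisRep K (PadicAlgCl p) 1, IsPAdicAvatarOf ι φ r → FactorsThroughZp κ r →
          IntSeries.HasValueAt Q (avatarValueAt r γ - 1)
            (((ι.symm (katzInterpolationValue p θK v vbar Cbar φ n ΩK (hL.continuation 1)) :
                PadicAlgCl p) : ℂ_[p]) * Ωp ^ (2 * n)))
    (hQ' : ∀ (φ : HeckeCharacter K) (n : ℕ), 0 < n → (p - 1) ∣ n →
        (∀ w : HeightOneSpectrum (𝓞 K), φ.IsUnramifiedAt w) →
        φ.HasInfinityType (fun _ ↦ (n : ℤ)) (fun _ ↦ -(n : ℤ)) →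
        ∀ (hL : LFunction.HasEntireContinuation (heckeLFunction (θK * φ))),
        ∀ r : FramedGaloisRep K (PadicAlgCl p) 1, IsPAdicAvatarOf ι φ r → FactorsThroughZp κ r →
          IntSeries.HasValueAt Q' (avatarValueAt r γ - 1)
            (((ι.symm (katzInterpolationValue p θK v vbar Cbar φ n ΩK' (hL.continuation 1)) :
                PadicAlgCl p) : ℂ_[p]) * Ωp' ^ (2 * n)))
    (h0 : Q = 0) : Q' = 0 := by
  obtain ⟨n, x₀, φ, r, hnpos, hndvd, -, hx1, hx, hunr, hinf, hr, hrκ, hval, hL⟩ :=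
    exists_katzSupply hp2 ι hK hκ hγ hfin
  have hT0 : Tendsto (fun k ↦ x₀ ^ p ^ k - 1) atTop (𝓝 0) := by
    have := hx.sub_const 1
    simpa using this
  refine R1.intSeries_eq_of_hasValueAt (v := fun _ ↦ 0) hT0
    (Frequently.of_forall fun k ↦ sub_ne_zero.mpr (hx1 k)) (fun k ↦ ?_)
    (fun k ↦ intSeries_hasValueAt_zero_series _)
  have h1 := hQ (φ k) _ (hnpos k) (hndvd k) (hunr _) (hinf _) (hL k) (r k) (hr _) (hrκ _)
  rw [hval, h0] at h1
  have hV0 := (intSeries_hasValueAt_zero_series (p := p) (x₀ ^ p ^ k - 1)).unique h1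
  have h2 := hQ' (φ k) _ (hnpos k) (hndvd k) (hunr _) (hinf _) (hL k) (r k) (hr _) (hrκ _)
  rw [hval, katzFrameValue_rescale ι θK v vbar Cbar (φ k) (n k) hΩK Ωp' hΩp, ← hV0, zero_mul] at h2
  exact h2

end Frames

/-! ### §4 `μ` and `λ` transfer from a ♭-frame to every `R₀`-frame -/

section Transfer

variable {ι : PadicAlgCl p ≃+* ℂ} {v vbar : HeightOneSpectrum (𝓞 K)} {Cbar : Finset (HeightOneSpectrum (𝓞 K))}
  {κ : ZpExtension K p} {γ : absoluteGaloisGroup K} {θK : HeckeCharacter K}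
  {ΩK : ℂ} {Ωp : ℂ_[p]} {ΩK'' : ℂ} {Ωp'' : ℂ_[p]} {Q : PowerSeries 𝓞_ℂ_[p]} {L : UnrSeries p}

/-- An `R₀`-frame read along `R₀ ⊆ 𝓞_{ℂ_p}` is a ♭-frame. [cite: CastellaGrossiLeeSkinner2022, Thm. 2.1.2] -/
theorem katzFlat_map_of_isKatzLFunction (hL : IsKatzLFunction ι v vbar Cbar κ γ θK ΩK'' Ωp'' L) :
    ∀ (φ : HeckeCharacter K) (n : ℕ), 0 < n → (p - 1) ∣ n →
        (∀ w : HeightOneSpectrum (𝓞 K), φ.IsUnramifiedAt w) →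
        φ.HasInfinityType (fun _ ↦ (n : ℤ)) (fun _ ↦ -(n : ℤ)) →
        ∀ (hLc : LFunction.HasEntireContinuation (heckeLFunction (θK * φ))),
        ∀ r : FramedGaloisRep K (PadicAlgCl p) 1, IsPAdicAvatarOf ι φ r → FactorsThroughZp κ r →
          IntSeries.HasValueAt (PowerSeries.map (R1.unrToCpInt p) L) (avatarValueAt r γ - 1)
            (((ι.symm (katzInterpolationValue p θK v vbar Cbar φ n ΩK'' (hLc.continuation 1)) :
                PadicAlgCl p) : ℂ_[p]) * Ωp'' ^ (2 * n)) :=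
  fun φ n hn hdvd hunr hinf hLc r hr hrκ ↦
    (R1.intSeries_hasValueAt_map_iff p L _ _).mpr (hL φ n hn hdvd hunr hinf hLc r hr hrκ)

/-- **`μ = 0` PASSES FROM A ♭-FRAME TO EVERY `R₀`-FRAME** of the same `θ_K` (any non-zero periods):
if `Q ∈ 𝓞_{ℂ_p}⟦T⟧` carries the CGLS interpolation property and has a coefficient of norm `1`, then every
`L ∈ R₀⟦T⟧` with `IsKatzLFunction ι v v̄ Cbar κ γ θ_K Ω_K'' Ω_p'' L` has a coefficient of norm `1`
(§3 + `UniversalToricDescentFlatMuTransfer.exists_coeff_norm_eq_one_of_flat_powerMap_identity`).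
[cite: CastellaGrossiLeeSkinner2022, Thm. 2.1.2] [cite: Washington1997, §7.1–7.2] -/
theorem exists_coeff_norm_eq_one_of_katzFlat_of_isKatzLFunction (hp2 : p ≠ 2)
    (hK : IsImaginaryQuadratic K) (hκ : κ.IsAnticyclotomic) (hγ : κ.IsTopGenerator γ)
    (hfin : θK.IsFiniteOrder) (hΩK : ΩK ≠ 0) (hΩp : Ωp ≠ 0) (hΩK'' : ΩK'' ≠ 0) (hΩp'' : Ωp'' ≠ 0)
    (hQ : ∀ (φ : HeckeCharacter K) (n : ℕ), 0 < n → (p - 1) ∣ n →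
        (∀ w : HeightOneSpectrum (𝓞 K), φ.IsUnramifiedAt w) →
        φ.HasInfinityType (fun _ ↦ (n : ℤ)) (fun _ ↦ -(n : ℤ)) →
        ∀ (hL : LFunction.HasEntireContinuation (heckeLFunction (θK * φ))),
        ∀ r : FramedGaloisRep K (PadicAlgCl p) 1, IsPAdicAvatarOf ι φ r → FactorsThroughZp κ r →
          IntSeries.HasValueAt Q (avatarValueAt r γ - 1)
            (((ι.symm (katzInterpolationValue p θK v vbar Cbar φ n ΩK (hL.continuation 1)) :
                PadicAlgCl p) : ℂ_[p]) * Ωp ^ (2 * n)))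
    (hL : IsKatzLFunction ι v vbar Cbar κ γ θK ΩK'' Ωp'' L)
    (hμ : ∃ i : ℕ, ‖((PowerSeries.coeff i Q : 𝓞_ℂ_[p]) : ℂ_[p])‖ = 1) :
    ∃ i : ℕ, ‖((PowerSeries.coeff i L : unrIntegers p) : ℂ_[p])‖ = 1 := by
  have hLflat := katzFlat_map_of_isKatzLFunction hL
  have hQ0 : Q ≠ 0 := by
    rintro rfl
    obtain ⟨i, hi⟩ := hμ
    simp at hi
  have hL0 : L ≠ 0 := by
    intro h
    apply hQ0
    refine katzFlat_eq_zero_of_eq_zero hp2 hK hκ hγ hfin hΩK'' hΩp'' hLflat hQ ?_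
    rw [h, map_zero]
  exact exists_coeff_norm_eq_one_of_flat_powerMap_identity hμ hL0
    (katzFlat_powerMap_identity hp2 hK hκ hγ hfin hΩK hΩp hQ hLflat)

/-- **THE FIRST-UNIT INDEX PASSES FROM A ♭-FRAME TO EVERY `R₀`-FRAME (AN-F₂, route (RIG), transfer
form).** `K` imaginary quadratic, `p` odd, `κ` anticyclotomic with topological generator `γ`, `θ_K` of
finite order, non-zero periods: if `Q ∈ 𝓞_{ℂ_p}⟦T⟧` carries the CGLS interpolation property of `θ_K`
and has its first unit coefficient at `m`, then EVERY `R₀`-frame `L` of `θ_K` has `FirstUnitCoeffAt L m`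
(`μ(L) = 0` by the previous theorem, so `L` has a first unit coefficient at some `m'`; `Q`, `L♭` satisfy
`L♭(Φ)·Q^p = L♭^p·Q(Φ)` (§3), and `firstUnitCoeffAt_eq_of_powMap_identity` gives `m' = m`).
[cite: CastellaGrossiLeeSkinner2022, Thm. 2.1.2 (arXiv:2008.02571v2 TeX L1015–1041)]
[cite: Washington1997, §7.1 Prop. 7.2, §7.2] -/
theorem firstUnitCoeffAt_of_katzFlat_of_isKatzLFunction (hp2 : p ≠ 2)
    (hK : IsImaginaryQuadratic K) (hκ : κ.IsAnticyclotomic) (hγ : κ.IsTopGenerator γ)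
    (hfin : θK.IsFiniteOrder) (hΩK : ΩK ≠ 0) (hΩp : Ωp ≠ 0) (hΩK'' : ΩK'' ≠ 0) (hΩp'' : Ωp'' ≠ 0)
    (hQ : ∀ (φ : HeckeCharacter K) (n : ℕ), 0 < n → (p - 1) ∣ n →
        (∀ w : HeightOneSpectrum (𝓞 K), φ.IsUnramifiedAt w) →
        φ.HasInfinityType (fun _ ↦ (n : ℤ)) (fun _ ↦ -(n : ℤ)) →
        ∀ (hL : LFunction.HasEntireContinuation (heckeLFunction (θK * φ))),
        ∀ r : FramedGaloisRep K (PadicAlgCl p) 1, IsPAdicAvatarOf ι φ r → FactorsThroughZp κ r →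
          IntSeries.HasValueAt Q (avatarValueAt r γ - 1)
            (((ι.symm (katzInterpolationValue p θK v vbar Cbar φ n ΩK (hL.continuation 1)) :
                PadicAlgCl p) : ℂ_[p]) * Ωp ^ (2 * n)))
    {m : ℕ} (hm : ‖((PowerSeries.coeff m Q : 𝓞_ℂ_[p]) : ℂ_[p])‖ = 1 ∧
      ∀ i < m, ‖((PowerSeries.coeff i Q : 𝓞_ℂ_[p]) : ℂ_[p])‖ < 1)
    (hL : IsKatzLFunction ι v vbar Cbar κ γ θK ΩK'' Ωp'' L) : FirstUnitCoeffAt L m := by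
  have hLflat := katzFlat_map_of_isKatzLFunction hL
  -- `μ(L) = 0`
  obtain ⟨i, hi⟩ := exists_coeff_norm_eq_one_of_katzFlat_of_isKatzLFunction hp2 hK hκ hγ hfin hΩK hΩp
    hΩK'' hΩp'' hQ hL ⟨m, hm.1⟩
  -- so `L` has a first unit coefficient at some `m'`
  obtain ⟨m', -, hm'⟩ := X1.KellerYinHalves.exists_firstUnitCoeffAt_of_exists_le (G := L) (N := i)
    ⟨i, le_rfl, by rw [hi]; exact lt_irrefl 1⟩
  -- read in `𝓞_{ℂ_p}⟦T⟧`
  have hm'flat : ‖((PowerSeries.coeff m' (PowerSeries.map (R1.unrToCpInt p) L) : 𝓞_ℂ_[p]) : ℂ_[p])‖ = 1 ∧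
      ∀ j < m', ‖((PowerSeries.coeff j (PowerSeries.map (R1.unrToCpInt p) L) : 𝓞_ℂ_[p]) : ℂ_[p])‖ < 1 := by
    refine ⟨?_, fun j hj ↦ ?_⟩
    · rw [PowerSeries.coeff_map, R1.coe_unrToCpInt]; exact hm'.1
    · rw [PowerSeries.coeff_map, R1.coe_unrToCpInt]; exact hm'.2 j hj
  -- `λ`-rigidity of the functional equation
  have hid := katzFlat_powerMap_identity hp2 hK hκ hγ hfin hΩK hΩp hQ hLflat
  have hmm' : m = m' := firstUnitCoeffAt_eq_of_powMap_identity m hm hm'flat hid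
  rw [hmm']
  exact hm'

/-- **AN-F₂ from the EXISTENCE of an `R₀`-frame** (the ideator's existential-to-existential shape:
`KatzLineDescentAt`'s hypothesis and conclusion, for a finite-order `θ_K`): if some `R₀`-frame of `θ_K`
exists (CGLS Thm. 2.1.2, `thm212_exists_isKatzLFunction`, at the plumbed binders) and some ♭-frame
`(Ω_K', Ω_p', Q)` with `‖Ω_p'‖ = 1` has its first unit coefficient at `m`, then some (indeed every)
`R₀`-frame `(Ω_K'', Ω_p'' ∈ R₀ˣ, L)` has `FirstUnitCoeffAt L m`. [cite: CastellaGrossiLeeSkinner2022, Thm. 2.1.2] -/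
theorem exists_isKatzLFunction_firstUnitCoeffAt_of_katzFlat (hp2 : p ≠ 2) (hK : IsImaginaryQuadratic K)
    (hκ : κ.IsAnticyclotomic) (hγ : κ.IsTopGenerator γ) (hfin : θK.IsFiniteOrder)
    (hex : ∃ (ΩK'' : ℂ) (Ωp'' : (unrIntegers p)ˣ) (L : UnrSeries p), ΩK'' ≠ 0 ∧
      IsKatzLFunction ι v vbar Cbar κ γ θK ΩK'' ((Ωp'' : unrIntegers p) : ℂ_[p]) L)
    {m : ℕ}
    (hflat : ∃ (ΩK' : ℂ) (Ωp' : ℂ_[p]) (Q : PowerSeries 𝓞_ℂ_[p]), ΩK' ≠ 0 ∧ ‖Ωp'‖ = 1 ∧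
      (∀ (φ : HeckeCharacter K) (n : ℕ), 0 < n → (p - 1) ∣ n →
        (∀ w : HeightOneSpectrum (𝓞 K), φ.IsUnramifiedAt w) →
        φ.HasInfinityType (fun _ ↦ (n : ℤ)) (fun _ ↦ -(n : ℤ)) →
        ∀ (hL : LFunction.HasEntireContinuation (heckeLFunction (θK * φ))),
        ∀ r : FramedGaloisRep K (PadicAlgCl p) 1, IsPAdicAvatarOf ι φ r → FactorsThroughZp κ r →
          IntSeries.HasValueAt Q (avatarValueAt r γ - 1)
            (((ι.symm (katzInterpolationValue p θK v vbar Cbar φ n ΩK' (hL.continuation 1)) :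
                PadicAlgCl p) : ℂ_[p]) * Ωp' ^ (2 * n))) ∧
      (‖((PowerSeries.coeff m Q : 𝓞_ℂ_[p]) : ℂ_[p])‖ = 1 ∧
        ∀ i < m, ‖((PowerSeries.coeff i Q : 𝓞_ℂ_[p]) : ℂ_[p])‖ < 1)) :
    ∃ (ΩK'' : ℂ) (Ωp'' : (unrIntegers p)ˣ) (L : UnrSeries p), ΩK'' ≠ 0 ∧
      IsKatzLFunction ι v vbar Cbar κ γ θK ΩK'' ((Ωp'' : unrIntegers p) : ℂ_[p]) L ∧
      FirstUnitCoeffAt L m := by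
  obtain ⟨ΩK'', Ωp'', L, hΩK'', hL⟩ := hex
  obtain ⟨ΩK', Ωp', Q, hΩK', hΩp', hQ, hm⟩ := hflat
  have hΩp'0 : Ωp' ≠ 0 := fun h ↦ by rw [h, norm_zero] at hΩp'; exact zero_ne_one hΩp'
  have hΩp''0 : ((Ωp'' : unrIntegers p) : ℂ_[p]) ≠ 0 := by
    rw [← norm_pos_iff, Halves.norm_coe_units_unrIntegers]; exact one_pos
  exact ⟨ΩK'', Ωp'', L, hΩK'', hL, firstUnitCoeffAt_of_katzFlat_of_isKatzLFunction hp2 hK hκ hγ hfin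
    hΩK' hΩp'0 hΩK'' hΩp''0 hQ hm hL⟩

end Transfer

end Summit.BirchSwinnertonDyer.BirchSwinnertonDyer.Theorems.KatzLineRigidity

end
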